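import Literature.Claims.NS.SuZhen2026
import HarnessLib

/-!
# D-0090 NS-CLAIMS, claim C140 `SuZhen2026` — kernel countermodel to the first failing typed step

Cell `ns-claims`; refuter of record `ns-claims-refuter-7` (g3) (typist `ns-claims-typist-5` g6, second refuter
`ns-claims-refuter-1` g4, referee `ns-claims-ref-3` g5, filer `ns-claims-salvage-p2` g5, 2-READ
`ns-claims-typist-10` g4). Source: Zhen Su, Zenodo record 20078410 («v2: Rigorous Full Proof», 2026-05-08),
10 pp. [SuZhen2026]. The theorems NEGATE `def … : Prop` faces of `Literature.Claims.NS.SuZhen2026` at the grain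
typed there; the countermodel is THE PRINTED FIELD ITSELF, `datum A = u_θ(r,z) e_θ` with
`u_θ(r,z) = A Φ(r,z) tanh z + δ₀ z`, `δ₀ = 1/10` (§5 p.7 l.151, p.8 l.158), for EVERY amplitude `A`.

* `not_Step5a_Smooth : ∀ A, ¬ Step5a_Smooth A` — §5 p.8 l.152 «This field is of class C^∞», the FIRST clause of
  the first consumed step of `claim_of_steps`. VERDICT OBJECT. Mechanism (junk-independent): on the line
  `s ↦ (s, 0, 2)` through the symmetry axis, `Φ = 0` (`|z| = 2 ≥ 1`), so `u_θ = δ₀·2 = 1/5` and the Cartesian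
  component `u₁(s,0,2) = (1/5)·s/|s|`: the one-sided limits at the axis are `+1/5` and `−1/5`, so NO value at the
  axis point makes the field continuous there, let alone `C^∞` (`datum_axisLine_one`, `tendsto_right`,
  `tendsto_left`). First failing step = `Step5a_Smooth` = p.8 l.152, class = false lemma (countermodel).
* `not_Step5b_Support`, `not_Step5b_Profile` : §5 p.8 l.152 «compactly supported in {0 ≤ r ≤ 1, |z| ≤ 1}» (the
  CARD-predicted locator, second clause of the same sentence): at `(1, 0, 2)` (`r = 1`, `|z| = 2 > 1`) the field
  is `(0, 1/5, 0) ≠ 0`; the summand `δ₀ z` carries no cut-off. By-slot companion, same class.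
* `not_Step5g_DzLower : 0 < A → ¬ Step5g_DzLower A` (p.8 l.160–161 «∂_z u_θ ≥ 0.056837A + δ₀» everywhere): at
  `r = 2` the profile is `s ↦ δ₀ s`, whose derivative is `δ₀`. (`Admissible A`, l.161–162, forces `0 < A`:
  `not_Step5g_DzLower_of_admissible`.) By-slot companion, same class.
* `not_Step5e_DzFormula : A ≠ 0 → ¬ Step5e_DzFormula A` (p.8 l.157 «A direct computation yields ∂_z u_θ =
  A Φ(r,z) sech²(z) + δ₀»): on the axis `r = 0` at `z = 1/2` the true derivative carries the product-rule term
  `A φ(0) φ′(1/2) tanh(1/2) ≠ 0` (`φ′(1/2) = −(16/9)e^{−4/3}`, `suZhen_hasDerivAt_bump_half`), and derivatives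
  are unique. (True for `A = 0`.) By-slot companion, same class.
* `not_Step0_LocalSolution : ∀ A, ¬ Step0_LocalSolution A` (the tacit «corresponding strong solution», p.9
  l.182–183): a local regular solution is classical on `[0,T) × ℝ³`, so its initial slice is `C^∞`; the printed
  field is not. CONSEQUENCE recorded, not a verdict: no `Chae2007.IsLocalSolution 1 T (datum A) u p` with
  `0 < T` exists, so the solution-grain faces (`Step4_KeyIneq`, `Step5h_StretchSol`, `Step6_Growth`,
  `Step6b_SupGrowth`, `Step6c_ExpIntegral`) carry no content from the printed displays §4 l.144, §6 l.165–179
  on this datum: for `0 < T` their hypotheses are unsatisfiable; at the degenerate horizon `T ≤ 0` (which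
  the faces do not exclude) the structure is trivially inhabited and the first four conclude vacuously, while
  `Step6c_ExpIntegral` is then false as typed — a typing-width artefact recorded by the REF (RETYPE v1c),
  repaired in the skeleton's rev 2 (`Step6cP_ExpIntegral` / `Step6cR_ExpIntegralReal`), and NOT keyed here.

Not decided here (noted for the record): `Step5c_DivFree` (true off the axis for any `u_θ(r,z)e_θ`; at the
axis the tree's junk frame makes the field non-differentiable — not pursued), `Step5f_DzPos` (false for `A ≥ 1`
near `(r,z) = (0, 0.8)`, numerics not certified here), `Step5h_StretchDatum`.

WHAT THIS IS NOT: not a claim about NS regularity or blow-up; not a claim about any author beyond the typed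
locator.
-/

noncomputable section

set_option linter.dupNamespace false

open Set Filter Topology
open scoped ContDiff

namespace Summit.NavierStokesRegularity.NavierStokesRegularity.Theorems.SuZhen2026

open Literature.Claims.NS.SuZhen2026
open Literature.Analysis.FluidPDE

/-! ### The printed profile off the cut-off -/

/-- The cut-off `Φ(r,z) = φ(r)φ(z)` vanishes off the `z`-slab: `Φ(r,z) = 0` for `|z| ≥ 1` (p.7 l.149–150). -/
theorem Phi_eq_zero_of_one_le_abs_z (r : ℝ) {z : ℝ} (hz : 1 ≤ |z|) : Phi r z = 0 := by
  unfold Phi bump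
  rw [if_neg (not_lt.2 hz), mul_zero]

/-- The cut-off vanishes outside the unit radius: `Φ(r,z) = 0` for `|r| ≥ 1` (p.7 l.149–150). -/
theorem Phi_eq_zero_of_one_le_abs_r {r : ℝ} (hr : 1 ≤ |r|) (z : ℝ) : Phi r z = 0 := by
  unfold Phi bump
  rw [if_neg (not_lt.2 hr), zero_mul]

/-- Off the `z`-slab the profile is the bare linear summand: `u_θ(r,z) = δ₀ z` for `|z| ≥ 1`. -/
theorem uTheta_of_one_le_abs_z (A r : ℝ) {z : ℝ} (hz : 1 ≤ |z|) : uTheta A r z = delta0 * z := by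
  unfold uTheta
  rw [Phi_eq_zero_of_one_le_abs_z r hz]
  ring

/-- Outside the unit radius the profile is the bare linear summand for every `z`: `u_θ(r,·) = δ₀ ·`
for `|r| ≥ 1`. -/
theorem uTheta_of_one_le_abs_r (A : ℝ) {r : ℝ} (hr : 1 ≤ |r|) (z : ℝ) : uTheta A r z = delta0 * z := by
  unfold uTheta
  rw [Phi_eq_zero_of_one_le_abs_r hr z]
  ring

/-- At height `z = 2`: `u_θ(r, 2) = 1/5` for every `r` and every amplitude. -/
theorem uTheta_two (A r : ℝ) : uTheta A r 2 = 1 / 5 := by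
  rw [uTheta_of_one_le_abs_z A r (by norm_num : (1 : ℝ) ≤ |2|)]
  unfold delta0
  norm_num

/-! ### The line `s ↦ (s, 0, 2)` through the symmetry axis -/

/-- The horizontal line `s ↦ (s, 0, 2)` crossing the axis at height `2`. -/
def axisLine (s : ℝ) : E3 := WithLp.toLp 2 ![s, 0, 2]

/-- The line is continuous. -/
theorem continuous_axisLine : Continuous axisLine := by
  unfold axisLine
  refine (PiLp.continuous_toLp 2 _).comp ?_
  refine continuous_pi fun i => ?_
  fin_cases i
  · simpa using continuous_id'
  · simpa using continuous_const
  · simpa using continuous_const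

/-- Cylindrical radius on the line: `r(s, 0, 2) = |s|`. -/
theorem cylRadius_axisLine (s : ℝ) : cylRadius (axisLine s) = |s| := by
  have h0 : axisLine s 0 = s := rfl
  have h1 : axisLine s 1 = 0 := rfl
  rw [cylRadius, h0, h1]
  simp [Real.sqrt_sq_eq_abs]

/-- The `x₁`-component of the printed field on the line: `u₁(s, 0, 2) = (1/5)·(|s|⁻¹ s)` — i.e. `+1/5`
for `s > 0`, `−1/5` for `s < 0` (and the frame's junk `0` at `s = 0`, never used below). -/
theorem datum_axisLine_one (A s : ℝ) : datum A (axisLine s) 1 = 1 / 5 * (|s|⁻¹ * s) := by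
  have h0 : axisLine s 0 = s := rfl
  have h2 : axisLine s 2 = 2 := rfl
  simp only [datum, eTheta, cylRadius_axisLine, h2, uTheta_two, PiLp.smul_apply, smul_eq_mul]
  have : (![-(axisLine s) 1, (axisLine s) 0, 0] : Fin 3 → ℝ) 1 = s := by rw [← h0]; rfl
  simp [this]

/-- Right limit at the axis: `u₁(s,0,2) → 1/5` as `s ↓ 0`. -/
theorem tendsto_right (A : ℝ) :
    Tendsto (fun s : ℝ => datum A (axisLine s) 1) (𝓝[>] 0) (𝓝 (1 / 5)) := by
  refine (tendsto_const_nhds (x := (1 / 5 : ℝ))).congr' ?_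
  filter_upwards [self_mem_nhdsWithin] with s hs
  rw [datum_axisLine_one, abs_of_pos hs, inv_mul_cancel₀ (ne_of_gt hs), mul_one]

/-- Left limit at the axis: `u₁(s,0,2) → −1/5` as `s ↑ 0`. -/
theorem tendsto_left (A : ℝ) :
    Tendsto (fun s : ℝ => datum A (axisLine s) 1) (𝓝[<] 0) (𝓝 (-(1 / 5))) := by
  refine (tendsto_const_nhds (x := (-(1 / 5) : ℝ))).congr' ?_
  filter_upwards [self_mem_nhdsWithin] with s hs
  have hs' : s ≠ 0 := ne_of_lt hs
  rw [datum_axisLine_one, abs_of_neg hs, inv_neg, neg_mul, inv_mul_cancel₀ hs']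
  ring

/-! ### Verdict object: §5 p.8 l.152 «This field is of class C^∞» is false for the printed field -/

/-- **`¬ Step5a_Smooth A` for every amplitude `A`** (§5 p.8 l.152 «This field is of class C^∞»): a `C^∞`
field is continuous, so along the line through the axis its `x₁`-component would have ONE limit at
`s = 0`; the printed field has right limit `1/5` and left limit `−1/5` there. First failing step of
`claim_of_steps`, class = false lemma (countermodel = the printed field itself). -/
theorem not_Step5a_Smooth (A : ℝ) : ¬ Step5a_Smooth A := by
  intro h
  have hf : Continuous fun s : ℝ => datum A (axisLine s) 1 :=
    (EuclideanSpace.proj (1 : Fin 3)).continuous.comp (h.continuous.comp continuous_axisLine)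
  have h0 : Tendsto (fun s : ℝ => datum A (axisLine s) 1) (𝓝 0) (𝓝 (datum A (axisLine 0) 1)) :=
    hf.continuousAt
  have hR : datum A (axisLine 0) 1 = 1 / 5 :=
    tendsto_nhds_unique (h0.mono_left nhdsWithin_le_nhds) (tendsto_right A)
  have hL : datum A (axisLine 0) 1 = -(1 / 5) :=
    tendsto_nhds_unique (h0.mono_left nhdsWithin_le_nhds) (tendsto_left A)
  linarith

/-! ### By-slot companions on the same object -/

/-- **`¬ Step5b_Support A` for every `A`** (§5 p.8 l.152 «compactly supported in {0 ≤ r ≤ 1, |z| ≤ 1}», the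
CARD-predicted locator): at `(1, 0, 2)` (`|z| = 2 > 1`) the field's `x₁`-component is `1/5`. -/
theorem not_Step5b_Support (A : ℝ) : ¬ Step5b_Support A := by
  intro h
  have hz : 1 < cylRadius (axisLine 1) ∨ 1 < |axisLine 1 2| :=
    Or.inr (by rw [show axisLine 1 2 = 2 from rfl]; norm_num)
  have := congrArg (fun v : E3 => v 1) (h (axisLine 1) hz)
  simp only [datum_axisLine_one, PiLp.zero_apply] at this
  norm_num at this

/-- **`¬ Step5b_Profile A` for every `A`** (the same clause on the printed cylindrical component):
`u_θ(1, 2) = 1/5 ≠ 0`. -/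
theorem not_Step5b_Profile (A : ℝ) : ¬ Step5b_Profile A := by
  intro h
  have := h 1 2 one_pos (Or.inr (by norm_num))
  rw [uTheta_two] at this
  norm_num at this

/-- **`¬ Step5g_DzLower A` for `A > 0`** (§5 p.8 l.160–161 «∂_z u_θ ≥ 0.056837A + δ₀» everywhere): at `r = 2`
the profile is `s ↦ δ₀ s` (no cut-off on the linear summand, cut-off `φ(2) = 0` on the other), with derivative
`δ₀ < 0.056837A + δ₀`. -/
theorem not_Step5g_DzLower {A : ℝ} (hA : 0 < A) : ¬ Step5g_DzLower A := by
  intro h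
  have hfun : (fun s : ℝ => uTheta A 2 s) = fun s => delta0 * s :=
    funext fun s => uTheta_of_one_le_abs_r A (by norm_num : (1 : ℝ) ≤ |2|) s
  have hder : deriv (fun s : ℝ => uTheta A 2 s) 0 = delta0 := by
    rw [hfun]
    exact ((hasDerivAt_id (0 : ℝ)).const_mul delta0).deriv.trans (mul_one _)
  have := h 2 0 (by norm_num)
  rw [hder] at this
  linarith

/-- The printed admissibility of the amplitude (l.161–162, `263.34 < 0.056837A + δ₀`) forces `0 < A`, so
the lower bound l.160–161 fails for every admissible amplitude. -/
theorem not_Step5g_DzLower_of_admissible {A : ℝ} (hA : Admissible A) : ¬ Step5g_DzLower A := by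
  refine not_Step5g_DzLower ?_
  unfold Admissible delta0 at hA
  linarith

/-! ### By-slot companion: the printed `z`-derivative (p.8 l.157) -/

/-- Inside `(-1, 1)` the bump is the analytic expression `e^{−1/(1−s²)}`; at `s = 1/2` it has the NON-ZERO
derivative `e^{−4/3}·(−16/9)`. -/
theorem suZhen_hasDerivAt_bump_half :
    HasDerivAt bump (Real.exp (-(1 / (1 - (1 / 2 : ℝ) ^ 2))) * (-(16 / 9))) (1 / 2) := by
  have h1 : HasDerivAt (fun s : ℝ => 1 - s ^ 2) (0 - (2 : ℕ) * (1 / 2 : ℝ) ^ (2 - 1)) (1 / 2) :=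
    (hasDerivAt_const (1 / 2 : ℝ) 1).sub (hasDerivAt_pow 2 (1 / 2 : ℝ))
  have hne : (1 : ℝ) - (1 / 2 : ℝ) ^ 2 ≠ 0 := by norm_num
  have h2 := (h1.inv hne).neg
  have h3 : HasDerivAt (fun s : ℝ => -(1 / (1 - s ^ 2)))
      (-(-(0 - (2 : ℕ) * (1 / 2 : ℝ) ^ (2 - 1)) / (1 - (1 / 2 : ℝ) ^ 2) ^ 2)) (1 / 2) := by
    refine h2.congr_of_eventuallyEq (Eventually.of_forall fun s => ?_)
    simp [one_div]
  have h4 := (Real.hasDerivAt_exp _).comp (1 / 2 : ℝ) h3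
  have hval : (-(-(0 - ((2 : ℕ) : ℝ) * (1 / 2 : ℝ) ^ (2 - 1)) / (1 - (1 / 2 : ℝ) ^ 2) ^ 2)) = -(16 / 9) := by
    norm_num
  rw [hval] at h4
  -- `bump` agrees with the analytic expression near `1/2`
  have hev : bump =ᶠ[𝓝 (1 / 2 : ℝ)] (Real.exp ∘ fun s : ℝ => -(1 / (1 - s ^ 2))) := by
    have hopen : IsOpen {s : ℝ | |s| < 1} := isOpen_lt continuous_abs continuous_const
    filter_upwards [hopen.mem_nhds (by show |(1 / 2 : ℝ)| < 1; norm_num)] with s hs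
    simp only [bump, Function.comp_apply, if_pos (show |s| < 1 from hs)]
  exact h4.congr_of_eventuallyEq hev

/-- **`¬ Step5e_DzFormula A` for `A ≠ 0`** (§5 p.8 l.157 «A direct computation yields ∂_z u_θ = A Φ(r,z)
sech²(z) + δ₀»): on the axis `r = 0` at `z = 1/2` the printed formula omits the product-rule term
`A φ(0) φ′(1/2) tanh(1/2) ≠ 0`; derivatives are unique. (For `A = 0` the display is true.) -/
theorem not_Step5e_DzFormula {A : ℝ} (hA : A ≠ 0) : ¬ Step5e_DzFormula A := by
  intro h
  -- `tanh′ = 1/cosh²` (Mathlib has the complex version only)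
  have hasDerivAt_tanh : ∀ x : ℝ, HasDerivAt Real.tanh (1 / Real.cosh x ^ 2) x := fun x => by
    have hc : Real.cosh x ≠ 0 := (Real.cosh_pos x).ne'
    have hd := (Real.hasDerivAt_sinh x).fun_div (Real.hasDerivAt_cosh x) hc
    have e : Real.tanh = fun y => Real.sinh y / Real.cosh y := funext Real.tanh_eq_sinh_div_cosh
    rw [e]
    refine hd.congr_deriv ?_
    have h1 : Real.cosh x * Real.cosh x - Real.sinh x * Real.sinh x = 1 := by
      nlinarith [Real.cosh_sq_sub_sinh_sq x]
    rw [h1]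
  set b : ℝ := Real.exp (-(1 / (1 - (1 / 2 : ℝ) ^ 2))) * (-(16 / 9)) with hb
  have hbump := suZhen_hasDerivAt_bump_half
  have htrue : HasDerivAt (fun s : ℝ => uTheta A 0 s)
      (A * bump 0 * (b * Real.tanh (1 / 2) + bump (1 / 2) * (1 / Real.cosh (1 / 2) ^ 2)) + delta0 * 1)
      (1 / 2) := by
    have hk := ((hbump.mul (hasDerivAt_tanh (1 / 2))).const_mul (A * bump 0)).add
      ((hasDerivAt_id (1 / 2 : ℝ)).const_mul delta0)
    have hfun : (fun s : ℝ => uTheta A 0 s) =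
        fun s => A * bump 0 * (bump s * Real.tanh s) + delta0 * id s := by
      funext s
      simp only [uTheta, Phi, id]
      ring
    rw [hfun]
    exact hk
  have hprinted := h 0 (1 / 2) le_rfl
  have heq := hprinted.unique htrue
  unfold dzUThetaPrinted Phi at heq
  have key : A * bump 0 * b * Real.tanh (1 / 2) = 0 := by linear_combination (-1 : ℝ) * heq
  have hb0 : bump 0 ≠ 0 := by
    simp only [bump, abs_zero, zero_lt_one, if_true]
    exact (Real.exp_pos _).ne'
  have hbne : b ≠ 0 := mul_ne_zero (Real.exp_pos _).ne' (by norm_num)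
  have ht : Real.tanh (1 / 2) ≠ 0 := by
    rw [Real.tanh_eq_sinh_div_cosh]
    exact div_ne_zero (ne_of_gt (Real.sinh_pos_iff.2 (by norm_num))) (Real.cosh_pos _).ne'
  exact (mul_ne_zero (mul_ne_zero (mul_ne_zero hA hb0) hbne) ht) key

/-- **`¬ Step0_LocalSolution A` for every `A`** (the tacit «corresponding strong solution», Thm 6.1 p.9
l.182–183, in the cell's class `Chae2007.IsLocalSolution`): such a solution is classical on `[0,T) × ℝ³`, so
its time-zero slice — the printed field — would be `C^∞`, contradicting `not_Step5a_Smooth`. Hence the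
solution-grain faces of the skeleton (`Step4_KeyIneq`, `Step5h_StretchSol`, `Step6_Growth`, `Step6b_SupGrowth`,
`Step6c_ExpIntegral`) have unsatisfiable hypotheses for every horizon `0 < T` (see the module docblock for the
degenerate horizon `T ≤ 0`). -/
theorem not_Step0_LocalSolution (A : ℝ) : ¬ Step0_LocalSolution A := by
  rintro ⟨T, hT, u, p, hsol⟩
  have h0 : (0 : ℝ) ∈ Ico 0 T := ⟨le_rfl, hT⟩
  have hsm : ContDiff ℝ ∞ (u 0) := hsol.isClassical.contDiff_velocity h0
  rw [hsol.initial] at hsm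
  exact not_Step5a_Smooth A hsm

end Summit.NavierStokesRegularity.NavierStokesRegularity.Theorems.SuZhen2026

end
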